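import Literature.Computability.FineGrained.SchoeningFourAlgorithm
import HarnessLib

/-!
# A biased-start Schöning walk for 4-SAT as a coin-string function, II: the dense case

Topic `Literature/Computability/FineGrained`; sequel of `SchoeningFourAlgorithm.lean` (line
`SchoeningFour*`, towards the named fact
`Literature.Computability.FineGrained.randSatExponent_four_lt_schoening`). Main result:
`pow_mul_le_cnt_ticket_mul` — for a satisfiable deduplicated 4-CNF with `m` selected clauses and
`c` further occurring variables (`n' = 4m + c` occurring variables in all), one ticket succeeds on
at least `2^(2·3S) · (64 · 259)^m · 4^c / (D · 3^(n'+1))` of its `cpt = 10m + c + 2·3S` coins,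
`D = (8n'+1)(4n'+1)`; i.e. with probability at least `(2/3)^n' · (259/256)^m / (3D)` — Schöning's
bound `(2/3)^n' / poly` improved by the factor `259/256` for every selected clause.

## The argument (Hofmeister–Schöning–Schuler–Watanabe 2002, §3, for 4-clauses)

Fix a satisfying assignment `z`. By Schöning's walk lemma (`SchoeningCoin.pow_le_cnt_walk_mul`,
`k = 4`, `d = 3`) the walk of a ticket started at `L` succeeds with probability at least
`3^(-dist(L,z)) / (3D)`, so it suffices to bound the generating function `Σ_L 3^(n' - dist(L,z))`
of the initial assignment from below. The initial assignment is a product (`initAll_eq`): every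
selected clause gets the truth-value pattern `tbl u` of its own `10` coins, every other occurring
variable its own coin. A uniform coin contributes the factor `3 + 1 = 4 = 2 · 2`
(`SchoeningCoin.lsum_pow_distX`); a selected clause `C` contributes
`Σ_{u<1024} 3^(4 - d(tbl u, z̃_C))`, where `z̃_C ≠ 0000` is the pattern of truth values of the
literals of `C` under `z`, and this sum is `≥ 16576 = 64 · 259` for each of the fifteen possible
`z̃_C` (`tbl_gain`, a finite check) — against `16 · 1024 = 64 · 256` for four uniform coins.

## References

* T. Hofmeister, U. Schöning, R. Schuler, O. Watanabe, *A probabilistic 3-SAT algorithm further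
  improved*, STACS 2002, LNCS 2285, 192–202, §3, Theorem 3 (success probability of the walk from a
  blockwise independent start: the product form) and §4 (the per-clause factor) [key
  `HofmeisterEtAl2002`].
* U. Schöning, *A probabilistic algorithm for k-SAT and constraint satisfaction problems*, Proc.
  40th FOCS (1999) 410–414, Theorem (proof: success `≥ (1/(k-1))^dist / poly` from distance `dist`)
  [key `SchoeningFOCS1999`].
-/

namespace Literature.Computability.FineGrained.SchoeningFour

open _root_.Computability Complexity SchoeningCoin Finset

variable {k : ℕ}

/-! ### Sums over coin blocks, continued -/

/-- Splitting a sum over blocks of length `a + b` into the first `a` and the last `b` coins.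
[folklore] -/
theorem lsum_append : ∀ (a b : ℕ) (f : List Bool → ℕ),
    lsum (a + b) f = lsum a (fun w => lsum b fun w' => f (w ++ w'))
  | 0, b, f => by rw [Nat.zero_add]; rfl
  | a + 1, b, f => by
    rw [Nat.succ_add, lsum, lsum, lsum_append a b, lsum_append a b]
    rfl

/-- A sum over `range (length l)` of a function of the entries is the sum over the list. [folklore] -/
theorem sum_range_getD {β : Type} (f : β → ℕ) (d : β) : ∀ l : List β,
    ∑ u ∈ range l.length, f (l.getD u d) = (l.map f).sum
  | [] => by simp
  | b :: l => by
    rw [List.length_cons, Finset.sum_range_succ', List.map_cons, List.sum_cons, add_comm]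
    simp only [List.getD_cons_succ, List.getD_cons_zero]
    rw [sum_range_getD f d l]

/-- The sum over a `flatMap` of replicates. [folklore] -/
theorem sum_map_flatMap_replicate {β : Type} (f : β → ℕ) (n : ℕ) : ∀ l : List β,
    ((l.flatMap fun p => List.replicate n p).map f).sum = n * (l.map f).sum
  | [] => by simp
  | b :: l => by
    rw [List.flatMap_cons, List.map_append, List.sum_append, sum_map_flatMap_replicate f n l, List.map_cons,
      List.sum_cons, List.map_replicate, List.sum_replicate, smul_eq_mul, Nat.mul_add]

/-! ### Hamming distance of patterns, and the gain of the table -/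

/-- The Hamming distance of two patterns (on their common prefix). [folklore] -/
def hd : List Bool → List Bool → ℕ
  | a :: p, b :: q => (if a = b then 0 else 1) + hd p q
  | _, _ => 0

/-- The Hamming distance to a pattern of length `4` is at most `4`. [folklore] -/
theorem hd_le_four (p : List Bool) (a b c e : Bool) : hd p [a, b, c, e] ≤ 4 := by
  rcases p with _ | ⟨p₁, _ | ⟨p₂, _ | ⟨p₃, _ | ⟨p₄, p⟩⟩⟩⟩ <;> simp [hd] <;> split_ifs <;> omega

/-- The weight of the table against the pattern `q`: `Σ_{p ∈ tblList} 3^(4 - hd p q)`. [folklore] -/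
def tblSum (q : List Bool) : ℕ := (tblList.map fun p => 3 ^ (4 - hd p q)).sum

/-- The weight of the table, by pattern classes. [folklore] -/
theorem tblSum_eq (q : List Bool) : tblSum q =
    86 * (pats1.map fun p => 3 ^ (4 - hd p q)).sum + 58 * (pats2.map fun p => 3 ^ (4 - hd p q)).sum +
      67 * (pats3.map fun p => 3 ^ (4 - hd p q)).sum + 64 * (pats4.map fun p => 3 ^ (4 - hd p q)).sum := by
  unfold tblSum tblList
  simp only [List.map_append, List.sum_append, sum_map_flatMap_replicate]

/-- **The gain of the biased table**: against every nonzero pattern of truth values the table weighs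
at least `16576 = 64 · 259`, against `16 · 1024 = 64 · 256` for four uniform coins (the minimum is
attained at the patterns of weight one). [cite: HofmeisterEtAl2002, §4 (the per-clause improvement factor, there `3/7` against `(3/4)³` for 3-clauses)] -/
theorem tblSum_ge (a b c e : Bool) (h : [a, b, c, e] ≠ [false, false, false, false]) :
    16576 ≤ tblSum [a, b, c, e] := by
  rw [tblSum_eq]
  revert a b c e
  decide

/-- The number of table entries equal to a nonzero pattern is at least `58`. [folklore] -/
theorem count_tblList_ge (a b c e : Bool) (h : [a, b, c, e] ≠ [false, false, false, false]) :
    58 ≤ tblList.count [a, b, c, e] := by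
  have key : ∀ q : List Bool, tblList.count q =
      86 * pats1.count q + 58 * pats2.count q + 67 * pats3.count q + 64 * pats4.count q := by
    intro q
    simp only [tblList, List.count_append, List.count_flatMap]
    have e : ∀ (n : ℕ) (l : List (List Bool)),
        (l.map (List.count q ∘ fun p => List.replicate n p)).sum = n * l.count q := by
      intro n l
      induction l with
      | nil => simp
      | cons p l ih =>
        rw [List.map_cons, List.sum_cons, ih, List.count_cons, Function.comp_apply, List.count_replicate]
        by_cases hp : p = q
        · subst hp; simp [Nat.mul_succ, Nat.add_comm]
        · simp [beq_false_of_ne hp]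
    rw [e, e, e, e]
  rw [key]
  revert a b c e
  decide

/-! ### Distances on disjoint sets of variables -/

/-- The distance on a disjoint union is the sum of the distances. [folklore] -/
theorem distX_union (a : ℕ → Bool) {A B : Finset ℕ} (h : Disjoint A B) (v : ℕ → Bool) :
    distX a (A ∪ B) v = distX a A v + distX a B v := by
  unfold distX
  rw [Finset.filter_union, Finset.card_union_eq_card_add_card.2 (Finset.disjoint_filter_filter h)]

/-! ### The block of a selected clause -/

/-- The pattern of truth values of the literals of `C` under `z`. [folklore] -/
def zpat (z : ℕ → Bool) (C : List (ℕ × Bool)) : List Bool := C.map fun l => z l.1 == l.2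

/-- A satisfied clause has a nonzero pattern. [folklore] -/
theorem zpat_ne (z : ℕ → Bool) {C : List (ℕ × Bool)} (hC : C.any (fun l => z l.1 == l.2) = true) :
    zpat z C ≠ [false, false, false, false] := by
  intro h
  obtain ⟨l, hl, hzl⟩ := List.any_eq_true.1 hC
  have : (z l.1 == l.2) ∈ zpat z C := List.mem_map.2 ⟨l, hl, rfl⟩
  rw [h, hzl] at this
  simp at this

/-- A literal gets the truth value of its pattern bit: `litVal s b` disagrees with `z x` iff `b`
differs from the truth value of the literal `(x, s)` under `z`. [folklore] -/
theorem litVal_ne_iff (s b zx : Bool) : litVal s b ≠ zx ↔ b ≠ (zx == s) := by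
  cases s <;> cases b <;> cases zx <;> decide

/-- **The block of a selected clause**: with four pairwise distinct variables, `pushSel C p L` gives
the variables of `C` values at Hamming distance `hd p (zpat z C)` from `z`. [folklore] -/
theorem distX_pushSel (z : ℕ → Bool) {C : List (ℕ × Bool)} (hlen : C.length = 4) (hnd : (C.map Prod.fst).Nodup)
    {p : List Bool} (hp : p.length = 4) (L : Asg) :
    distX z (C.map Prod.fst).toFinset (pushSel C p L).val = hd p (zpat z C) := by
  obtain ⟨l₁, l₂, l₃, l₄, rfl⟩ : ∃ l₁ l₂ l₃ l₄, C = [l₁, l₂, l₃, l₄] := by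
    rcases C with _ | ⟨l₁, _ | ⟨l₂, _ | ⟨l₃, _ | ⟨l₄, _ | ⟨l₅, C⟩⟩⟩⟩⟩ <;> simp at hlen
    exact ⟨l₁, l₂, l₃, l₄, rfl⟩
  obtain ⟨b₁, b₂, b₃, b₄, rfl⟩ : ∃ b₁ b₂ b₃ b₄, p = [b₁, b₂, b₃, b₄] := by
    rcases p with _ | ⟨b₁, _ | ⟨b₂, _ | ⟨b₃, _ | ⟨b₄, _ | ⟨b₅, p⟩⟩⟩⟩⟩ <;> simp at hp
    exact ⟨b₁, b₂, b₃, b₄, rfl⟩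
  simp only [List.map_cons, List.map_nil, List.nodup_cons, List.mem_cons, List.not_mem_nil, or_false,
    not_or] at hnd
  obtain ⟨⟨h12, h13, h14⟩, ⟨h23, h24⟩, h34, -⟩ := hnd
  have hv : pushSel [l₁, l₂, l₃, l₄] [b₁, b₂, b₃, b₄] L =
      (l₄.1, litVal l₄.2 b₄) :: (l₃.1, litVal l₃.2 b₃) :: (l₂.1, litVal l₂.2 b₂) :: (l₁.1, litVal l₁.2 b₁) :: L := rfl
  set L' : Asg := (l₄.1, litVal l₄.2 b₄) :: (l₃.1, litVal l₃.2 b₃) :: (l₂.1, litVal l₂.2 b₂) ::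
    (l₁.1, litVal l₁.2 b₁) :: L with hL'
  have v1 : L'.val l₁.1 = litVal l₁.2 b₁ := by simp [hL', Asg.val_cons, Ne.symm h12, Ne.symm h13, Ne.symm h14]
  have v2 : L'.val l₂.1 = litVal l₂.2 b₂ := by simp [hL', Asg.val_cons, Ne.symm h23, Ne.symm h24]
  have v3 : L'.val l₃.1 = litVal l₃.2 b₃ := by simp [hL', Asg.val_cons, Ne.symm h34]
  have v4 : L'.val l₄.1 = litVal l₄.2 b₄ := by simp [hL', Asg.val_cons]
  rw [hv]
  simp only [List.map_cons, List.map_nil, List.toFinset_cons, List.toFinset_nil]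
  rw [distX_insert z (by simp [h12, h13, h14]), distX_insert z (by simp [h23, h24]), distX_insert z (by simp [h34]),
    distX_insert z (Finset.notMem_empty _), v1, v2, v3, v4]
  simp only [distX, Finset.filter_empty, Finset.card_empty, Nat.zero_add, zpat, List.map_cons, List.map_nil, hd,
    Nat.add_zero, ne_eq, litVal_ne_iff]
  by_cases g1 : b₁ = (z l₁.1 == l₁.2) <;> by_cases g2 : b₂ = (z l₂.1 == l₂.2) <;>
    by_cases g3 : b₃ = (z l₃.1 == l₃.2) <;> by_cases g4 : b₄ = (z l₄.1 == l₄.2) <;> simp [g1, g2, g3, g4]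

/-- **The weight of one block**: summed over the `1024` coin values, `3^(4 - dist)` on the variables
of a satisfied selected clause weighs at least `16576`. [cite: HofmeisterEtAl2002, §4] -/
theorem sum_pow_distX_pushSel_ge (z : ℕ → Bool) {C : List (ℕ × Bool)} (hlen : C.length = 4)
    (hnd : (C.map Prod.fst).Nodup) (hC : C.any (fun l => z l.1 == l.2) = true) (L : Asg) :
    16576 ≤ ∑ u ∈ range 1024, 3 ^ (4 - distX z (C.map Prod.fst).toFinset (pushSel C (tbl u) L).val) := by
  have e : ∀ u : ℕ, 3 ^ (4 - distX z (C.map Prod.fst).toFinset (pushSel C (tbl u) L).val) =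
      (fun p => 3 ^ (4 - hd p (zpat z C))) (tblList.getD u [true, true, true, true]) := fun u => by
    simp only
    rw [distX_pushSel z hlen hnd (length_tbl u) L]
    rfl
  simp only [e]
  have hs := sum_range_getD (fun p => 3 ^ (4 - hd p (zpat z C))) [true, true, true, true] tblList
  rw [← length_tblList, hs]
  obtain ⟨a, b, c, d, hq⟩ : ∃ a b c d, zpat z C = [a, b, c, d] := by
    have : (zpat z C).length = 4 := by simp [zpat, hlen]
    rcases hz : zpat z C with _ | ⟨a, _ | ⟨b, _ | ⟨c, _ | ⟨d, _ | ⟨x, q⟩⟩⟩⟩⟩ <;> rw [hz] at this <;> simp at this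
    exact ⟨a, b, c, d, rfl⟩
  have hne := zpat_ne z hC
  rw [hq] at hne ⊢
  exact tblSum_ge a b c d hne

/-! ### Values of the laid lists -/

/-- `pushSel` does not change the values outside the variables of the clause. [folklore] -/
theorem val_pushSel_of_not_mem : ∀ (C : List (ℕ × Bool)) (p : List Bool) (L : Asg) (x : ℕ),
    x ∉ C.map Prod.fst → (pushSel C p L).val x = L.val x
  | [], p, L, x, _ => by cases p <;> rfl
  | l :: C, [], L, x, _ => rfl
  | l :: C, b :: p, L, x, hx => by
    rw [pushSel, val_pushSel_of_not_mem C p _ x (fun h => hx (by simp [h])), Asg.val_cons, if_neg]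
    intro h; exact hx (by simp [h])

/-- `laySel` does not change the values outside the variables of the laid clauses. [folklore] -/
theorem val_laySel_of_not_mem : ∀ (Cs : List (List (ℕ × Bool))) (w : List Bool) (L : Asg) (x : ℕ),
    (∀ C ∈ Cs, x ∉ C.map Prod.fst) → (laySel Cs w L).val x = L.val x
  | [], w, L, x, _ => rfl
  | C :: Cs, w, L, x, h => by
    rw [laySel, val_laySel_of_not_mem Cs _ _ x (fun D hD => h D (List.mem_cons_of_mem _ hD)),
      val_pushSel_of_not_mem C _ L x (h C List.mem_cons_self)]

/-- The variables of a list of clauses. [folklore] -/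
def varsOf (Cs : List (List (ℕ × Bool))) : Finset ℕ := (Cs.flatMap fun C => C.map Prod.fst).toFinset

/-- `varsOf` of a cons. [folklore] -/
theorem varsOf_cons (C : List (ℕ × Bool)) (Cs : List (List (ℕ × Bool))) :
    varsOf (C :: Cs) = (C.map Prod.fst).toFinset ∪ varsOf Cs := by
  simp [varsOf, List.toFinset_append]

/-- `varsOf` has at most `4` variables per clause of width `4`. [folklore] -/
theorem card_varsOf_le : ∀ Cs : List (List (ℕ × Bool)), (∀ C ∈ Cs, C.length = 4) → (varsOf Cs).card ≤ 4 * Cs.length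
  | [], _ => by simp [varsOf]
  | C :: Cs, h => by
    rw [varsOf_cons]
    refine (Finset.card_union_le _ _).trans ?_
    have h1 : (C.map Prod.fst).toFinset.card ≤ 4 := by
      refine (List.toFinset_card_le _).trans ?_
      rw [List.length_map, h C List.mem_cons_self]
    have h2 := card_varsOf_le Cs fun D hD => h D (List.mem_cons_of_mem _ hD)
    rw [List.length_cons]; omega

/-- **The weight of the selected blocks**: over the `10 · |Cs|` coins of pairwise variable-disjoint
satisfied clauses of width `4` with distinct variables, `3^(4|Cs| - dist)` on their variables weighs at
least `16576^|Cs|`, whatever the list below. [cite: HofmeisterEtAl2002, §3, Theorem 3 (the product form over independent clauses)] -/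
theorem pow_le_lsum_laySel (z : ℕ → Bool) : ∀ (Cs : List (List (ℕ × Bool))),
    (∀ C ∈ Cs, C.length = 4) → (∀ C ∈ Cs, (C.map Prod.fst).Nodup) →
    (∀ C ∈ Cs, C.any (fun l => z l.1 == l.2) = true) →
    Cs.Pairwise (fun C D => ∀ l ∈ C, ∀ m ∈ D, l.1 ≠ m.1) → ∀ L : Asg,
    16576 ^ Cs.length ≤ lsum (10 * Cs.length) fun w => 3 ^ (4 * Cs.length - distX z (varsOf Cs) (laySel Cs w L).val)
  | [], _, _, _, _, L => by simp [lsum, varsOf, distX, laySel]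
  | C :: Cs, hlen, hnd, hsat, hpw, L => by
    rw [List.length_cons, show 10 * (Cs.length + 1) = 10 + 10 * Cs.length by ring,
      show 4 * (Cs.length + 1) = 4 * Cs.length + 4 by ring, lsum_append, pow_succ]
    obtain ⟨hCD, hpw'⟩ := List.pairwise_cons.1 hpw
    have hlenC := hlen C List.mem_cons_self
    have hdisj : Disjoint (C.map Prod.fst).toFinset (varsOf Cs) := by
      rw [Finset.disjoint_left]
      intro x hx hx'
      rw [List.mem_toFinset, List.mem_map] at hx
      obtain ⟨l, hl, rfl⟩ := hx
      simp only [varsOf, List.mem_toFinset, List.mem_flatMap, List.mem_map] at hx'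
      obtain ⟨D, hD, m, hm, hml⟩ := hx'
      exact hCD D hD l hl m hm hml.symm
    have IH := pow_le_lsum_laySel z Cs (fun D hD => hlen D (List.mem_cons_of_mem _ hD))
      (fun D hD => hnd D (List.mem_cons_of_mem _ hD)) (fun D hD => hsat D (List.mem_cons_of_mem _ hD)) hpw'
    -- the summand splits
    have key : ∀ w : List Bool, w.length = 10 → ∀ w' : List Bool, w'.length = 10 * Cs.length →
        3 ^ (4 * Cs.length + 4 - distX z (varsOf (C :: Cs)) (laySel (C :: Cs) (w ++ w') L).val) =
          3 ^ (4 - distX z (C.map Prod.fst).toFinset (pushSel C (tbl (bval w)) L).val) *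
            3 ^ (4 * Cs.length - distX z (varsOf Cs) (laySel Cs w' (pushSel C (tbl (bval w)) L)).val) := by
      intro w hw w' hw'
      rw [laySel, List.take_append_of_le_length (by omega), List.take_of_length_le (by omega),
        List.drop_append_of_le_length (by omega), List.drop_of_length_le (by omega), List.nil_append,
        varsOf_cons, distX_union z hdisj, ← pow_add]
      have e1 : distX z (C.map Prod.fst).toFinset (laySel Cs w' (pushSel C (tbl (bval w)) L)).val =
          distX z (C.map Prod.fst).toFinset (pushSel C (tbl (bval w)) L).val :=
        distX_congr z _ fun y hy => val_laySel_of_not_mem Cs w' _ y fun D hD hyD => by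
          rw [List.mem_toFinset, List.mem_map] at hy
          obtain ⟨l, hl, rfl⟩ := hy
          rw [List.mem_map] at hyD
          obtain ⟨m, hm, hml⟩ := hyD
          exact hCD D hD l hl m hm hml.symm
      rw [e1]
      have hd1 : distX z (C.map Prod.fst).toFinset (pushSel C (tbl (bval w)) L).val ≤ 4 := by
        rw [distX_pushSel z hlenC (hnd C List.mem_cons_self) (length_tbl _)]
        obtain ⟨a, b, c, d, hq⟩ : ∃ a b c d, zpat z C = [a, b, c, d] := by
          have : (zpat z C).length = 4 := by simp [zpat, hlenC]
          rcases hz : zpat z C with _ | ⟨a, _ | ⟨b, _ | ⟨c, _ | ⟨d, _ | ⟨x, q⟩⟩⟩⟩⟩ <;> rw [hz] at this <;> simp at this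
          exact ⟨a, b, c, d, rfl⟩
        rw [hq]; exact hd_le_four _ _ _ _ _
      have hd2 : distX z (varsOf Cs) (laySel Cs w' (pushSel C (tbl (bval w)) L)).val ≤ 4 * Cs.length :=
        (distX_le _ _).trans (card_varsOf_le Cs fun D hD => hlen D (List.mem_cons_of_mem _ hD))
      congr 1; omega
    calc 16576 ^ Cs.length * 16576
        ≤ 16576 ^ Cs.length * lsum 10 (fun w => 3 ^ (4 - distX z (C.map Prod.fst).toFinset (pushSel C (tbl (bval w)) L).val)) := by
          refine Nat.mul_le_mul_left _ ?_
          rw [show (10 : ℕ) = 10 from rfl, lsum_bval 10 (fun u => 3 ^ (4 - distX z (C.map Prod.fst).toFinset (pushSel C (tbl u) L).val))]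
          exact sum_pow_distX_pushSel_ge z hlenC (hnd C List.mem_cons_self) (hsat C List.mem_cons_self) L
      _ = lsum 10 (fun w => 3 ^ (4 - distX z (C.map Prod.fst).toFinset (pushSel C (tbl (bval w)) L).val) * 16576 ^ Cs.length) := by
          rw [lsum_mul', mul_comm]
      _ ≤ lsum 10 (fun w => lsum (10 * Cs.length) fun w' =>
            3 ^ (4 * Cs.length + 4 - distX z (varsOf (C :: Cs)) (laySel (C :: Cs) (w ++ w') L).val)) := by
          refine lsum_mono fun w hw => ?_
          rw [lsum_congr (fun w' hw' => key w hw w' hw'), lsum_mul]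
          exact Nat.mul_le_mul_left _ (IH _)

/-! ### The variables of `φ`: the selected blocks and the rest -/

section Vars

variable (φ : KCNF k)

/-- The variables of the selected clauses of `φ`. [folklore] -/
def hset : Finset ℕ := varsOf (selCls φ.clauses [])

/-- The variables taking a coin in the conditional pass, as a set. [folklore] -/
def cset : Finset ℕ := (cvars φ).toFinset

/-- A variable is selected iff it is in `hset`. [folklore] -/
theorem memV_hl_iff (x : ℕ) : memV (hl φ) x = true ↔ x ∈ hset φ := by
  unfold hl hset varsOf
  rw [memV_hAfter, memV_nil, Bool.false_or, List.any_eq_true, List.mem_toFinset, List.mem_flatMap]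
  simp only [List.any_eq_true, beq_iff_eq, List.mem_map]

/-- The selected variables occur. [folklore] -/
theorem hset_subset_vars : hset φ ⊆ vars φ := by
  intro x hx
  unfold hset varsOf at hx
  rw [List.mem_toFinset, List.mem_flatMap] at hx
  obtain ⟨C, hC, hxC⟩ := hx
  unfold vars occs
  rw [List.mem_toFinset, List.mem_flatMap]
  exact ⟨C, mem_of_mem_selCls hC, hxC⟩

/-- The conditional variables occur and are not selected. [folklore] -/
theorem mem_cset_iff (x : ℕ) : x ∈ cset φ ↔ x ∈ vars φ ∧ x ∉ hset φ := by
  unfold cset cvars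
  rw [List.mem_toFinset, mem_newVars_iff, map_fst_occL, ← memV_hl_iff]
  unfold vars
  rw [List.mem_toFinset]
  simp

/-- **The occurring variables are the selected ones and the conditional ones**, disjointly. [folklore] -/
theorem vars_eq_union : vars φ = hset φ ∪ cset φ := by
  ext x
  rw [Finset.mem_union, mem_cset_iff]
  constructor
  · intro hx; by_cases h : x ∈ hset φ
    · exact Or.inl h
    · exact Or.inr ⟨hx, h⟩
  · rintro (h | ⟨h, -⟩)
    · exact hset_subset_vars φ h
    · exact h

/-- `hset` and `cset` are disjoint. [folklore] -/
theorem disjoint_hset_cset : Disjoint (hset φ) (cset φ) := by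
  rw [Finset.disjoint_left]
  intro x hx hx'
  exact ((mem_cset_iff φ x).1 hx').2 hx

/-- The number of conditional variables. [folklore] -/
theorem card_cset : (cset φ).card = (cvars φ).length :=
  List.toFinset_card_of_nodup (nodup_newVars _ _)

/-- The number of selected variables is at most `4` per selected clause. [folklore] -/
theorem card_hset_le : (hset φ).card ≤ 4 * nSel φ.clauses [] :=
  card_varsOf_le _ fun _ hC => length_of_mem_selCls hC

/-- The number of occurring variables: at most `4` per selected clause plus the conditional ones.
[folklore] -/
theorem nv_le : nv φ ≤ 4 * nSel φ.clauses [] + (cvars φ).length := by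
  unfold nv
  rw [vars_eq_union, Finset.card_union_eq_card_add_card.2 (disjoint_hset_cset φ), card_cset]
  have := card_hset_le φ
  omega

/-- With distinct variables in every clause, the selected variables are exactly `4` per selected
clause. [folklore] -/
theorem card_hset (hnd : ∀ C ∈ φ.clauses, (C.map Prod.fst).Nodup) : (hset φ).card = 4 * nSel φ.clauses [] := by
  unfold hset varsOf nSel
  obtain ⟨-, hpw⟩ := selCls_disjoint φ.clauses []
  rw [List.toFinset_card_of_nodup]
  · generalize hCs : selCls φ.clauses [] = Cs
    have hlen : ∀ C ∈ Cs, C.length = 4 := fun C hC => length_of_mem_selCls (hCs ▸ hC)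
    clear hpw hCs
    induction Cs with
    | nil => rfl
    | cons C Cs ih =>
      rw [List.flatMap_cons, List.length_append, List.length_map, hlen C List.mem_cons_self,
        ih (fun D hD => hlen D (List.mem_cons_of_mem _ hD)), List.length_cons]
      ring
  · rw [List.nodup_flatMap]
    refine ⟨fun C hC => hnd C (mem_of_mem_selCls hC), ?_⟩
    refine hpw.imp fun {C D} h => ?_
    simp only [Function.onFun, List.disjoint_left, List.mem_map]
    rintro x ⟨l, hl, rfl⟩ ⟨m, hm, hml⟩
    exact h l hl m hm hml.symm

/-- **The number of occurring variables** is `4` per selected clause plus the conditional ones.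
[folklore] -/
theorem nv_eq (hnd : ∀ C ∈ φ.clauses, (C.map Prod.fst).Nodup) : nv φ = 4 * nSel φ.clauses [] + (cvars φ).length := by
  unfold nv
  rw [vars_eq_union, Finset.card_union_eq_card_add_card.2 (disjoint_hset_cset φ), card_cset, card_hset φ hnd]

end Vars

/-! ### The generating function of the initial assignment -/

/-- The distance of the laid initial list splits: the conditional coins decide the conditional
variables, the blocks the selected ones. [folklore] -/
theorem dist_init_eq (φ : KCNF k) (z : ℕ → Bool) (w₁ w₂ : List Bool) (hw₂ : w₂.length = (cvars φ).length) :
    distX z (vars φ) (Lxs (cvars φ) w₂ ++ laySel (selCls φ.clauses []) w₁ []).val =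
      distX z (hset φ) (laySel (selCls φ.clauses []) w₁ []).val + distX z (cset φ) (Lxs (cvars φ) w₂).val := by
  rw [vars_eq_union, distX_union z (disjoint_hset_cset φ)]
  congr 1
  · refine distX_congr z _ fun y hy => ?_
    rw [Asg.val_append, any_Lxs hw₂]
    have : y ∉ cvars φ := fun h => (Finset.disjoint_left.1 (disjoint_hset_cset φ)) hy (List.mem_toFinset.2 h)
    simp [this]
  · refine distX_congr z _ fun y hy => ?_
    rw [Asg.val_append, any_Lxs hw₂]
    have : y ∈ cvars φ := List.mem_toFinset.1 hy
    simp [this]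

/-- **The weight of the initial assignment**: over the `nInit` coins of the initialisation of a
satisfied, deduplicated `φ` with `m` selected clauses and `c` conditional variables,
`Σ 3^(n' - dist) ≥ 16576^m · 4^c`. [cite: HofmeisterEtAl2002, §3, Theorem 3] -/
theorem pow_mul_pow_le_lsum_init (φ : KCNF k) {z : ℕ → Bool} (hz : φ.eval z = true)
    (hnd : ∀ C ∈ φ.clauses, (C.map Prod.fst).Nodup) :
    16576 ^ nSel φ.clauses [] * 4 ^ (cvars φ).length ≤
      lsum (nInit φ) fun w => 3 ^ (nv φ - dist φ z (initAll φ w).2.1) := by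
  set m := nSel φ.clauses [] with hm
  set c := (cvars φ).length with hc
  unfold nInit
  rw [lsum_append]
  have hsat : ∀ C ∈ selCls φ.clauses [], C.any (fun l => z l.1 == l.2) = true := fun C hC => by
    unfold KCNF.eval at hz
    exact List.all_eq_true.1 hz C (mem_of_mem_selCls hC)
  have hcard : (cvars φ).toFinset.card = c := List.toFinset_card_of_nodup (nodup_newVars _ _)
  -- the inner sum: the conditional coins
  have inner : ∀ w₁ : List Bool, w₁.length = 10 * m →
      lsum c (fun w₂ => 3 ^ (nv φ - dist φ z (initAll φ (w₁ ++ w₂)).2.1)) =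
        3 ^ (4 * m - distX z (hset φ) (laySel (selCls φ.clauses []) w₁ []).val) * 4 ^ c := by
    intro w₁ hw₁
    have e : ∀ w₂ : List Bool, w₂.length = c → 3 ^ (nv φ - dist φ z (initAll φ (w₁ ++ w₂)).2.1) =
        3 ^ (4 * m - distX z (hset φ) (laySel (selCls φ.clauses []) w₁ []).val) *
          (1 ^ distX z (cvars φ).toFinset (Lxs (cvars φ) w₂).val *
            3 ^ ((cvars φ).toFinset.card - distX z (cvars φ).toFinset (Lxs (cvars φ) w₂).val)) := by
      intro w₂ hw₂
      have hI := initAll_eq φ w₁ w₂ [] hw₁ hw₂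
      rw [List.append_nil] at hI
      rw [hI, one_pow, one_mul, ← pow_add]
      simp only
      unfold SchoeningCoin.dist
      rw [dist_init_eq φ z w₁ w₂ hw₂, nv_eq φ hnd, show cset φ = (cvars φ).toFinset from rfl, hcard]
      have h1 : distX z (hset φ) (laySel (selCls φ.clauses []) w₁ []).val ≤ 4 * m :=
        (distX_le _ _).trans (card_hset_le φ)
      have h2 : distX z (cvars φ).toFinset (Lxs (cvars φ) w₂).val ≤ c := (distX_le _ _).trans hcard.le
      congr 1
      omega
    rw [lsum_congr e, lsum_mul, show c = (cvars φ).length from rfl, lsum_pow_distX z 1 3 (cvars φ), hcard,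
      Nat.sub_self, pow_zero, one_mul]
  rw [lsum_congr inner, lsum_mul']
  refine Nat.mul_le_mul_right _ ?_
  obtain ⟨-, hpw⟩ := selCls_disjoint φ.clauses []
  have := pow_le_lsum_laySel z (selCls φ.clauses []) (fun C hC => length_of_mem_selCls hC)
    (fun C hC => hnd C (mem_of_mem_selCls hC)) hsat hpw []
  exact this

/-! ### The success probability of one ticket: the dense case -/

/-- **Success of one ticket, dense form.** For a satisfied, deduplicated `k`-CNF (`3 ≤ k ≤ 2^d`,
`2^d n' < S`) with `m` selected clauses and `c` conditional variables, over the `cpt` coins of a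
ticket: `2^(2dS) · 16576^m · 4^c ≤ #{success} · (2^d n' + 1)(k n' + 1)(k-1)^(n'+k-3) · 3^n' / (k-1)^n'`
— stated for `k = 4`, where `(k-1)^n'` cancels: `2^(2dS) · 16576^m · 4^c ≤ #{success} · D · 3^(n'+1)`.
Since `16576 = 64 · 259` and `2^cpt = 1024^m · 2^c · 2^(2dS)`, the success probability is at least
`(2/3)^n' (259/256)^m / (3 D)`. [cite: HofmeisterEtAl2002, §3, Theorem 3 and §4; SchoeningFOCS1999, Theorem] -/
theorem pow_mul_le_cnt_ticket_mul (φ : KCNF 4) {z : ℕ → Bool} (hz : φ.eval z = true)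
    (hnd : ∀ C ∈ φ.clauses, (C.map Prod.fst).Nodup) {d S : ℕ} (hd4 : 4 ≤ 2 ^ d) (hS : 2 ^ d * nv φ < S) :
    2 ^ (d * S) * 2 ^ (d * S) * 16576 ^ nSel φ.clauses [] * 4 ^ (cvars φ).length ≤
      cnt (cpt φ d S) {w | (ticket φ d S w).1 = true} *
        ((2 ^ d * nv φ + 1) * (4 * nv φ + 1) * 3 ^ (nv φ + 1)) := by
  set D := (2 ^ d * nv φ + 1) * (4 * nv φ + 1) with hD
  unfold cpt
  rw [show nInit φ + S * d + S * d = nInit φ + (d * S + d * S) by ring, cnt_add_eq_lsum]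
  -- per initial block: the walk from the laid list
  have key : ∀ w : List Bool, w.length = nInit φ →
      2 ^ (d * S) * 2 ^ (d * S) * 3 ^ (nv φ - dist φ z (initAll φ w).2.1) ≤
        cnt (d * S + d * S) {r | w ++ r ∈ {w | (ticket φ d S w).1 = true}} * (D * 3 ^ (nv φ + 1)) := by
    intro w hw
    set L := (initAll φ w).2.1 with hL
    have hwalk := pow_le_cnt_walk_mul (k := 4) (φ := φ) (a := z) (d := d) hz (by norm_num) hd4 hS L
    rw [show (4 : ℕ) - 1 = 3 from rfl, show (4 : ℕ) - 3 = 1 from rfl, ← hD] at hwalk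
    -- tickets whose first walk succeeds
    have hsub : cnt (d * S) {r | (walk φ d S L r).1 = true} * 2 ^ (d * S) ≤
        cnt (d * S + d * S) {r | w ++ r ∈ {w | (ticket φ d S w).1 = true}} := by
      rw [cnt_add_eq_lsum, cnt_eq_lsum, ← lsum_mul']
      refine lsum_mono fun w₂ hw₂ => ?_
      split_ifs with h
      · rw [one_mul]
        have : cnt (d * S) {r | w₂ ++ r ∈ {r | w ++ r ∈ {w | (ticket φ d S w).1 = true}}} = cnt (d * S) Set.univ := by
          refine cnt_congr fun w₃ _ => ?_
          simp only [Set.mem_setOf_eq, Set.mem_univ, iff_true]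
          unfold ticket
          rw [initAll_append φ w _ hw, ← hL]
          simp only
          rw [(walk_append φ d S L w₂ w₃ (by rw [hw₂, mul_comm])).1, h]
          simp
        rw [this, cnt_univ]
      · rw [zero_mul]; exact Nat.zero_le _
    have hdist : dist φ z L ≤ nv φ := distX_le _ _
    calc 2 ^ (d * S) * 2 ^ (d * S) * 3 ^ (nv φ - dist φ z L)
        ≤ cnt (d * S) {r | (walk φ d S L r).1 = true} * (D * 3 ^ (dist φ z L + 1)) * 2 ^ (d * S) *
            3 ^ (nv φ - dist φ z L) :=
          Nat.mul_le_mul_right _ (Nat.mul_le_mul_right _ hwalk)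
      _ = cnt (d * S) {r | (walk φ d S L r).1 = true} * 2 ^ (d * S) * (D * 3 ^ (nv φ + 1)) := by
          rw [show nv φ + 1 = (dist φ z L + 1) + (nv φ - dist φ z L) by omega, pow_add _ (dist φ z L + 1)]
          ring
      _ ≤ _ := Nat.mul_le_mul_right _ hsub
  calc 2 ^ (d * S) * 2 ^ (d * S) * 16576 ^ nSel φ.clauses [] * 4 ^ (cvars φ).length
      ≤ 2 ^ (d * S) * 2 ^ (d * S) * lsum (nInit φ) (fun w => 3 ^ (nv φ - dist φ z (initAll φ w).2.1)) := by
        rw [mul_assoc, mul_assoc, mul_assoc]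
        refine Nat.mul_le_mul_left _ (Nat.mul_le_mul_left _ ?_)
        exact pow_mul_pow_le_lsum_init φ hz hnd
    _ = lsum (nInit φ) (fun w => 2 ^ (d * S) * 2 ^ (d * S) * 3 ^ (nv φ - dist φ z (initAll φ w).2.1)) := by
        rw [lsum_mul]
    _ ≤ lsum (nInit φ) (fun w => cnt (d * S + d * S) {r | w ++ r ∈ {w | (ticket φ d S w).1 = true}} *
          (D * 3 ^ (nv φ + 1))) := lsum_mono key
    _ = _ := by rw [lsum_mul']

end Literature.Computability.FineGrained.SchoeningFour
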